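import Mathlib
import Summits.KontsevichZagierPeriods.KontsevichZagierPeriods.Theorems.SoloInformedKappaPath
import Summits.KontsevichZagierPeriods.KontsevichZagierPeriods.Theorems.SoloInformedGridSum
import HarnessLib

/-!
# SoloInformed — `κ` over a grid: from cellwise relations to the (HT) identity

File I4c of the (HT) step (`SoloInformedNashHT`) of the solo-informed programme: the abstract
gluing of cellwise relations with the grid telescoping (`soloInformed_grid_concat`) and the
subdivision formula (`soloInformed_kappaPath_subdiv`).

A grid consists of horizontal edges `hor i j` and vertical edges `ver i j` (arbitrary maps
`ℝ → ℂⁿ`; `κ` of an arbitrary map is `soloInformedKappaOpt` = `κ` if Nash, else `0`).  If every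
cell satisfies `κ(B) + κ(R) − κ(T) − κ(L) = 0`, the left column consists of the `M₀` pieces of `a`
followed by the `M₀` pieces of `b`, the right column of the `M₀ + M₀` pieces of `d`, and the bottom
and top rows carry `κ = 0`, then `κ(a) + κ(b) = κ(d)` (`soloInformed_HT_of_grid`).  The cellwise
relation itself (a Coons cell in one chart, `soloInformed_kappaPath_coons`) is supplied by the user
(`SoloInformedHTEdges.lean`).

References: Huber–Wüstholz, *Transcendence and linear relations of 1-periods* (2022), §7.2, §13.1;
Kontsevich–Zagier, *Periods* (2001), §1.2.
-/

noncomputable section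

open scoped BigOperators Topology
open Set Metric MvPolynomial
open Literature.NumberTheory.Transcendental Literature.NumberTheory.Transcendental.KZ
open Literature.NumberTheory.Transcendental.CurvePeriods
open Literature.ModelTheory.ExponentialFields

namespace Summit.KontsevichZagierPeriods.KontsevichZagierPeriods.Theorems

variable {n : ℕ}

open Classical in
/-- `κ` of an arbitrary map: `κ(ω, γ)` if `γ` is Nash, else `0`. -/
def soloInformedKappaOpt (ω : Fin n → MvPolynomial (Fin n) ℂ) (hω : ∀ i, HasAlgCoeffs (ω i))
    (γ : ℝ → Fin n → ℂ) : SoloInformedV :=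
  if h : SoloInformedIsNashPath γ then soloInformedKappaPath ω hω γ h else 0

/-- On a Nash map `κOpt = κ`. -/
theorem soloInformedKappaOpt_eq (ω : Fin n → MvPolynomial (Fin n) ℂ) (hω : ∀ i, HasAlgCoeffs (ω i))
    {γ : ℝ → Fin n → ℂ} (h : SoloInformedIsNashPath γ) :
    soloInformedKappaOpt ω hω γ = soloInformedKappaPath ω hω γ h := by
  rw [soloInformedKappaOpt, dif_pos h]

/-- `κ` of a Nash map is the sum of `κOpt` of its `N` pieces. -/
theorem soloInformed_kappaPath_eq_sum_kappaOpt (ω : Fin n → MvPolynomial (Fin n) ℂ)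
    (hω : ∀ i, HasAlgCoeffs (ω i)) {γ : ℝ → Fin n → ℂ} (h : SoloInformedIsNashPath γ) {N : ℕ}
    (hN : 0 < N) :
    soloInformedKappaPath ω hω γ h =
      ∑ k : Fin N, soloInformedKappaOpt ω hω (soloInformedPiecePath γ N k) := by
  rw [soloInformed_kappaPath_subdiv ω hω h hN]
  exact Finset.sum_congr rfl fun k _ =>
    (soloInformedKappaOpt_eq ω hω (soloInformed_isNashPath_piece h k.2)).symm

/-- **(HT) from a grid.**  If every cell of an `N × (M₀ + M₀)` grid of maps satisfies
`κOpt(B) + κOpt(R) − κOpt(T) − κOpt(L) = 0`, the left column consists of the pieces of `a` and then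
of `b`, the right column of the pieces of `d`, and the bottom and top rows have `κOpt = 0`, then
`κ(a) + κ(b) = κ(d)`. -/
theorem soloInformed_HT_of_grid (ω : Fin n → MvPolynomial (Fin n) ℂ) (hω : ∀ i, HasAlgCoeffs (ω i))
    {a b d : ℝ → Fin n → ℂ} (ha : SoloInformedIsNashPath a) (hb : SoloInformedIsNashPath b)
    (hd : SoloInformedIsNashPath d) {N M₀ : ℕ} (hM₀ : 0 < M₀) (hor ver : ℕ → ℕ → ℝ → Fin n → ℂ)
    (hcell : ∀ i < N, ∀ j < M₀ + M₀,
      soloInformedKappaOpt ω hω (hor i j) + soloInformedKappaOpt ω hω (ver (i + 1) j) -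
        soloInformedKappaOpt ω hω (hor i (j + 1)) - soloInformedKappaOpt ω hω (ver i j) = 0)
    (verA : ∀ j < M₀, ver 0 j = soloInformedPiecePath a M₀ j)
    (verB : ∀ j < M₀, ver 0 (M₀ + j) = soloInformedPiecePath b M₀ j)
    (verD : ∀ j < M₀ + M₀, ver N j = soloInformedPiecePath d (M₀ + M₀) j)
    (horBot : ∀ i < N, soloInformedKappaOpt ω hω (hor i 0) = 0)
    (horTop : ∀ i < N, soloInformedKappaOpt ω hω (hor i (M₀ + M₀)) = 0) :
    soloInformedKappaPath ω hω a ha + soloInformedKappaPath ω hω b hb =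
      soloInformedKappaPath ω hω d hd := by
  have h := soloInformed_grid_concat (fun j i => soloInformedKappaOpt ω hω (hor i j))
    (fun i j => soloInformedKappaOpt ω hω (ver i j)) N M₀
    (fun j => soloInformedKappaOpt ω hω (soloInformedPiecePath a M₀ j))
    (fun j => soloInformedKappaOpt ω hω (soloInformedPiecePath b M₀ j))
    (fun j => soloInformedKappaOpt ω hω (soloInformedPiecePath d (M₀ + M₀) j))
    hcell horBot horTop (fun j hj => by simp only [verA j hj]) (fun j hj => by simp only [verB j hj])
    (fun j hj => by simp only [verD j hj])
  rw [soloInformed_kappaPath_eq_sum_kappaOpt ω hω ha hM₀,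
    soloInformed_kappaPath_eq_sum_kappaOpt ω hω hb hM₀,
    soloInformed_kappaPath_eq_sum_kappaOpt ω hω hd (Nat.add_pos_left hM₀ M₀)]
  exact h

end Summit.KontsevichZagierPeriods.KontsevichZagierPeriods.Theorems
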